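import Summits.ResolutionOfSingularities.ResolutionOfSingularities.Theorems.RadicialJungCleanModelsSufficeChartsKN
import Summits.ResolutionOfSingularities.ResolutionOfSingularities.Theorems.RadicialJungCleanModelsSufficeCharts
import Summits.ResolutionOfSingularities.ResolutionOfSingularities.Theorems.RadicialJungCleanModelsSufficeFrame

/-!
# Route `RadicialJung`, crux `CleanModelsSuffice` (stmt-ResolutionOfSingularities-15883), line `Sketch`:
# stub `stub_adaptedKN` — an adapted model's normalisation is resolved by Kato (10.4) ALONE

Skeleton v3.2 of the crux
`Summit.ResolutionOfSingularities.ResolutionOfSingularities.Theses.RadicialJung.CleanModelsSuffice`.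
Let `V` be regular, integral, separated and of finite type over a field `k` of characteristic `p`,
`L/K(V)` purely inseparable of degree `p`, and `D : AdaptedData p V L` log-clean data ADAPTED to a
global boundary (pointwise presentations whose boundary sections are jointly part of regular systems
where they vanish, pairwise compatible on overlaps). Then, granted Kato 1994 (10.4)
(`Kato1994_logRegularScheme_hasResolution`, the ONE named fact of the line), the normalisation `V^L` of
`V` in `L` has a resolution.

Proof. The Kato charts of `D` (`D.W`, `D.P`, `D.chart` of `…ChartsFamily`) cover `V^L`, are fs, log
regular at every stalk and pairwise compatible — UNCONDITIONALLY, by `…ChartsKN`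
(`isLogRegularLocal_chartKN`, `chart_compatibleKN`: the chain formerly conditional on Kato (4.1), now
fed by the proved Kummer normality `kummerNormal`). `V^L` is locally Noetherian
(`isLocallyNoetherian_normalizationIn_of_finrank`) and quasi-compact (finite over the quasi-compact
`V`), so `atlasOfCharts` assembles a log-regular Zariski fs atlas and Kato (10.4) resolves it.

Compared with `hasResolution_normalizationIn_of_adaptedModel` (`…Reduction`, v2.9) the named fact
Kato (4.1) (`hK4`) is GONE.
-/

noncomputable section

set_option linter.dupNamespace false -- mandated namespace of this single-conjunct summit

open CategoryTheory AlgebraicGeometry TopologicalSpace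
open Literature.AlgebraicGeometry.Resolution IsLocalRing

namespace Summit.ResolutionOfSingularities.ResolutionOfSingularities.Theorems.RadicialJung.CleanModelsSuffice

/-- STUB `stub_adaptedKN` (adapted models are resolved by Kato (10.4), WITHOUT Kato (4.1)). Granted
Kato 1994 (10.4), the normalisation `V^L` of a regular `V` (integral, separated, of finite type over a
field of characteristic `p`; `L/K(V)` purely inseparable of degree `p`) carrying ADAPTED log-clean data
`D` has a resolution: the Kato charts of `D` form a log-regular Zariski fs atlas on `V^L`
(`atlasOfCharts` on `isLogRegularLocal_chartKN` / `chart_compatibleKN`, which rest on the PROVED Kummer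
normality instead of Kato (4.1)) and Kato (10.4) resolves it. [folklore] -/
theorem stub_adaptedKN
    (hK : Kato1994_logRegularScheme_hasResolution.{0})
    (p : ℕ) (hp : p.Prime) (k : Type) [Field k] [CharP k p]
    (V : Scheme.{0}) [IsIntegral V] (f : V ⟶ Spec (.of k)) (L : Type) [Field L]
    [Algebra V.functionField L] [IsSeparated f] [LocallyOfFiniteType f] [QuasiCompact f]
    (hVreg : Scheme.IsRegular V) [IsPurelyInseparable V.functionField L]
    (hdeg : Module.finrank V.functionField L = p) (D : AdaptedData p V L) :
    Scheme.HasResolution (normalizationIn V L) := by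
  haveI : CharP V.functionField p := Picover.TowerTransport.charP_functionField V f
  haveI : FiniteDimensional V.functionField L :=
    Module.finite_of_finrank_pos (by rw [hdeg]; exact hp.pos)
  -- `V^L` is locally Noetherian and quasi-compact
  have hLN : IsLocallyNoetherian (normalizationIn V L) :=
    isLocallyNoetherian_normalizationIn_of_finrank p hp k V f L hdeg
  haveI : CompactSpace V := QuasiCompact.compactSpace_of_compactSpace f
  haveI : IsFinite (normalizationInι V L) := isFinite_normalizationInι V L f
  haveI : CompactSpace (normalizationIn V L) :=
    QuasiCompact.compactSpace_of_compactSpace (normalizationInι V L)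
  -- the Kato charts of `D`: a log-regular Zariski fs atlas (no Kato (4.1))
  obtain ⟨𝒜, h𝒜⟩ := atlasOfCharts (normalizationIn V L) hLN ({v : V // 0 < D.m v} ⊕ V) D.W D.n
    (D.P stub_normalizeExponents hp hdeg) (D.chart stub_normalizeExponents hp hdeg) D.cover
    (D.fs stub_normalizeExponents hp hdeg) (D.isLogRegularLocal_chartKN hp hdeg hVreg)
    (D.chart_compatibleKN hp hdeg hVreg)
  -- Kato (10.4)
  exact hK _ 𝒜 inferInstance h𝒜

end Summit.ResolutionOfSingularities.ResolutionOfSingularities.Theorems.RadicialJung.CleanModelsSuffice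

end
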